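import Mathlib.Analysis.Fourier.RiemannLebesgueLemma
import Mathlib.Analysis.SpecialFunctions.Pow.Integral
import Mathlib.Analysis.SpecialFunctions.Trigonometric.Bounds
import Literature.Probability.LatticeModels.TorusFourier
import Literature.Probability.LatticeModels.ThermodynamicLimit
import HarnessLib

/-!
# The lattice Green function of `ℤ^d` and its finite-volume (torus) approximants

Trunk G02 (T-STATMECH), topic `Probability/LatticeModels`, namespace `Literature.StatMech`.
Pure-analysis inputs of the infrared-bound proof that the long-range order parameter of the
free critical Ising state vanishes in `d ≥ 3`,

* M. Aizenman, H. Duminil-Copin, V. Sidoravicius, *Random currents and continuity of Ising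
  model's spontaneous magnetization*, Comm. Math. Phys. **334** (2015) 719–742, §3.3,
  eqs. (3.14)–(3.16) of arXiv:1311.1937v3 (bib key `AizenmanDuminilCopinSidoraviciusCMP2015`;
  "ADS15"; **all equation numbers below are those of arXiv v3, the version held in the literature
  store; the journal numbering differs**),

specialised to the nearest-neighbour couplings. Normalisation: ADS15's energy function (1.17),
`E(p) = ∑_x (1 - e^{ip·x}) J_{0,x}`, equals `2 ε(p)` **exactly** for nearest-neighbour couplings,
where `ε(p) = ∑ᵢ (1 - cos pᵢ)` is the prelude's `dispersion`. We build the Green functions on `ε`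
rather than `E`, so that `torusGreen = 2 × G_L^{ADS15}` and `latticeGreen = 2 × G^{ADS15}`; this is
the normalisation of the tree's infrared bound `Literature.Probability.LatticeModels.infraredBound`
(`Ĝ_L(p) ≤ 1 / (2β ε(p))`, Friedli–Velenik 2017, Thm. 10.24), under which the Gaussian-domination
inequality ADS15 (3.13) is to be vendored downstream as `∑ v v F ≤ (2β)⁻¹ ∑ v v torusGreen + …`
(ADS15's printed constant `1/(2βE(p))` with their `E` is smaller by a factor `2` and fails already
for `d = 1`, `L → ∞`: `Ĝ(π) = e^{-2β} > 1/(8β)` at `β = 1/2`). All theorems in this file are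
invariant under rescaling the Green functions by a positive constant.

## Contents

* `torusGreen z = L^{-d} ∑_{k ≠ 0} cos (p_k · z) / ε(p_k)` (`z ∈ (ℤ/Lℤ)^d`, `p_k = 2πk/L`) — twice
  the finite-volume Green function `G_L` of ADS15 (3.14), on the torus `(ℤ/Lℤ)^d`;
* `brillouin d = [-π, π]^d` and `latticeGreen z = ∫_{[-π,π]^d} cos (p·z) / ε(p) dp / (2π)^d`
  (`z ∈ ℤ^d`) — twice the limit Green function `G` of ADS15 (3.15); equivalently `d⁻¹ ×` the Green
  function `∑_n P(S_n = z)` of simple random walk on `ℤ^d` (whose symbol is `1 - d⁻¹∑ᵢ cos pᵢ =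
  ε(p)/d`), or `2 ×` the Green function of the lattice Laplacian (symbol `2 ε(p)`);
* `mul_norm_sq_le_dispersion` — `ε(p) ≥ (2/π²) ‖p‖²_∞` on `[-π,π]^d` (Jordan's inequality), the
  nearest-neighbour case of "`E(p) ≈ |p|²`" (ADS15 §1.4);
* `integrable_indicator_inv_dispersion` — ADS15's condition (1.18), `∫ dp / E(p) < ∞`, holds for
  `d ≥ 3` (Mathlib's `locallyIntegrable_of_norm_le_rpow`: `‖p‖^{-2}` is locally integrable in
  dimension `> 2`);
* `tendsto_latticeGreen_cofinite` — `G(z) → 0` as `|z| → ∞` for `d ≥ 3`, by the Riemann–Lebesgue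
  lemma (Mathlib `tendsto_integral_exp_smul_cocompact`, applied through the functionals
  `phaseFunctional z : p ↦ -(2π)⁻¹ p·z`, for which `𝐞(-w_z(p)) = e^{i p·z}`);
* `tendsto_blockAverage_of_tendsto_cofinite` — Cesàro: a kernel decaying at infinity has
  vanishing double block averages `|Λ_N|⁻² ∑_{x,y ∈ Λ_N} G(x - y) → 0`;
* `tendsto_latticeGreen_blockAverage` — **ADS15 eq. (3.16)**, proved:
  `lim_N |Λ_N|⁻² ∑_{x,y ∈ Λ_N} G(x - y) = 0` for `d ≥ 3`.

The companion statement of ADS15 (3.15), `G_L → G` pointwise (Riemann sums of the integrable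
singularity `1/ε`), is proved in a companion file (in preparation).

## Design notes

* `torusGreen` is real: we sum `cos (p_k·z)` (the sine parts of `e^{i p_k·z}` cancel under
  `k ↦ -k`); the phase `∑ᵢ p_k,i (z i).val` uses the representatives `(z i).val`, legitimate since
  `p_k ∈ (2π/L)ℤ^d` (it is the real number `Literature.Hubbard.torusPhase L k z` of
  `MathematicalPhysics/QuantumLattice/XYOrderProofs.lean`, which we do not import — wrong dependency
  direction — nor re-declare). Division by `ε(p_k) = 0` cannot occur for `k ≠ 0` (`0 < L`;
  cf. `Literature.MathematicalPhysics.QuantumLattice.dispersion_latticeMomentum_pos`); by `L^d`, never (`[NeZero L]`).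
* `latticeGreen` is a Bochner set integral; for `d ≤ 2` the integrand is not integrable and the
  value is junk (`0`); all theorems about it carry `3 ≤ d`.
* No new physics: this file imports only the torus Fourier prelude (`dispersion`,
  `latticeMomentum`) and boxes (`box`). Binders: `d` (and `L`) are implicit wherever a later
  explicit argument determines them (as for the prelude's `dispersion`, `latticeMomentum`).

## Mathlib status

Mathlib has the Riemann–Lebesgue lemma, local integrability of `‖x‖^{-α}` (`α < dim`) and Jordan's
inequality (`Real.cos_le_one_sub_mul_cos_sq`), all used here; it has no lattice Green function
(searched `Green function`, `latticeGreen`, `randomWalk` Green).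
-/

noncomputable section

open MeasureTheory Filter Topology Finset Real
open scoped FourierTransform

namespace Literature.Probability.LatticeModels

variable {d : ℕ}

/-! ### Definitions -/

/-- The finite-volume lattice Green function on the torus `(ℤ/Lℤ)^d`,
`torusGreen z = L^{-d} ∑_{k ≠ 0} cos (p_k · z) / ε(p_k)` with `p_k = 2πk/L` (`latticeMomentum`),
`p_k · z = ∑ᵢ p_k,i (z i).val` (the phase `Literature.Hubbard.torusPhase L k z` of the quantum-lattice
files, written out here) and `ε(p) = ∑ᵢ (1 - cos pᵢ)` (`dispersion`). This is **twice** the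
function `G_L(x,y) = ∑_{p ≠ 0} L^{-d} e^{ip·(x-y)}/E(p)` of Aizenman–Duminil-Copin–Sidoravicius,
CMP 334 (2015), §3.3, arXiv v3 eq. (3.14), at `z = x - y`, because their energy function
(arXiv v3 (1.17)) is `E(p) = 2 ε(p)` exactly for nearest-neighbour couplings; the
`ε`-normalisation matches the tree's infrared bound `Literature.Probability.LatticeModels.infraredBound`
(`Ĝ_L(p) ≤ 1/(2β ε(p))`, Friedli–Velenik 2017, Thm. 10.24). Real-valued: the sine parts of
`e^{i p_k·z}` cancel under `k ↦ -k`. Requires `L ≠ 0` (finite torus). [cite: AizenmanDuminilCopinSidoraviciusCMP2015, §3.3, arXiv v3 eq. (3.14)] -/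
def torusGreen {L : ℕ} [NeZero L] (z : TorusSite d L) : ℝ :=
  (∑ k ∈ (univ : Finset (TorusSite d L)).erase 0,
      Real.cos (∑ i, latticeMomentum L k i * ((z i).val : ℝ)) / dispersion (latticeMomentum L k)) /
    ((L : ℝ) ^ d)

variable (d) in
/-- The Brillouin zone `[-π, π]^d` of `ℤ^d` (Aizenman–Duminil-Copin–Sidoravicius, CMP 334 (2015),
§1.4 and §3.3, arXiv v3 eqs. (1.18) and (3.15); Friedli–Velenik 2017, §8.4). [cite: AizenmanDuminilCopinSidoraviciusCMP2015, §1.4, arXiv v3 eq. (1.18)] -/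
def brillouin : Set (Fin d → ℝ) :=
  Set.pi Set.univ fun _ => Set.Icc (-π) π

/-- The lattice Green function of `ℤ^d`,
`latticeGreen z = ∫_{[-π,π]^d} cos (p · z) / ε(p) dp / (2π)^d`, `ε(p) = ∑ᵢ (1 - cos pᵢ)`. This is
**twice** the function `G(x,y) = ∫_{[-π,π]^d} e^{ip·(x-y)}/E(p) dp/(2π)^d` of
Aizenman–Duminil-Copin–Sidoravicius, CMP 334 (2015), §3.3, arXiv v3 eq. (3.15), at `z = x - y`
(`E = 2ε` for nearest-neighbour couplings, cf. `torusGreen`); it is also `d⁻¹` times the Green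
function of simple
random walk on `ℤ^d` (symbol `1 - d⁻¹ ∑ᵢ cos pᵢ = ε(p)/d`) and twice the Green function of the
lattice Laplacian (symbol `2ε(p)`). The integrand is integrable iff `d ≥ 3`
(`ε(p) ≥ (2/π²)|p|²_∞`, `integrable_indicator_inv_dispersion`); for `d ≤ 2` the Bochner integral
is the junk value `0`. [cite: AizenmanDuminilCopinSidoraviciusCMP2015, §3.3, arXiv v3 eq. (3.15)] -/
def latticeGreen (z : Site d) : ℝ :=
  (∫ p in brillouin d, Real.cos (∑ i, p i * (z i : ℝ)) / dispersion p) / ((2 * π) ^ d)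

/-! ### The Brillouin zone and the dispersion relation -/

variable (d) in
/-- `[-π,π]^d` is compact. [folklore] -/
theorem isCompact_brillouin : IsCompact (brillouin d) :=
  isCompact_univ_pi fun _ => isCompact_Icc

variable (d) in
/-- `[-π,π]^d` is measurable. [folklore] -/
theorem measurableSet_brillouin : MeasurableSet (brillouin d) :=
  MeasurableSet.univ_pi fun _ => measurableSet_Icc

variable (d) in
/-- The dispersion relation `ε(p) = ∑ᵢ (1 - cos pᵢ)` is continuous. [folklore] -/
theorem continuous_dispersion : Continuous (dispersion : (Fin d → ℝ) → ℝ) := by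
  unfold dispersion; fun_prop

/-- **Quadratic lower bound on the dispersion relation** on the Brillouin zone:
`ε(p) ≥ (2/π²) ‖p‖²_∞` for `p ∈ [-π,π]^d`, from Jordan's inequality
`1 - cos x ≥ (2/π²) x²` on `[-π,π]` (Mathlib `Real.cos_le_one_sub_mul_cos_sq`). This is the
nearest-neighbour case of "`E(p) ≈ |p|²`" in Aizenman–Duminil-Copin–Sidoravicius, CMP 334 (2015),
§1.4. [cite: AizenmanDuminilCopinSidoraviciusCMP2015, §1.4] -/
theorem mul_norm_sq_le_dispersion {p : Fin d → ℝ} (hp : p ∈ brillouin d) :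
    2 / π ^ 2 * ‖p‖ ^ 2 ≤ dispersion p := by
  have hcoord : ∀ i, 2 / π ^ 2 * (p i) ^ 2 ≤ 1 - Real.cos (p i) := fun i => by
    have h := Real.cos_le_one_sub_mul_cos_sq (x := p i) (abs_le.2 (hp i (Set.mem_univ _)))
    linarith
  have hterm : ∀ i, (p i) ^ 2 ≤ π ^ 2 / 2 * dispersion p := fun i => by
    have h1 : 1 - Real.cos (p i) ≤ dispersion p :=
      Finset.single_le_sum (f := fun j => 1 - Real.cos (p j))
        (fun j _ => sub_nonneg.2 (Real.cos_le_one _)) (mem_univ i)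
    have h2 := hcoord i
    have hπ : (0 : ℝ) < π ^ 2 := by positivity
    calc (p i) ^ 2 = π ^ 2 / 2 * (2 / π ^ 2 * (p i) ^ 2) := by field_simp
      _ ≤ π ^ 2 / 2 * dispersion p := by gcongr; linarith
  have hnn : 0 ≤ π ^ 2 / 2 * dispersion p := by
    have := dispersion_nonneg p; positivity
  have hnorm : ‖p‖ ≤ Real.sqrt (π ^ 2 / 2 * dispersion p) := by
    refine (pi_norm_le_iff_of_nonneg (Real.sqrt_nonneg _)).2 fun i => ?_
    rw [Real.norm_eq_abs]
    exact Real.abs_le_sqrt (hterm i)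
  have hsq : ‖p‖ ^ 2 ≤ π ^ 2 / 2 * dispersion p := by
    calc ‖p‖ ^ 2 ≤ Real.sqrt (π ^ 2 / 2 * dispersion p) ^ 2 := by gcongr
      _ = π ^ 2 / 2 * dispersion p := Real.sq_sqrt hnn
  have hπ : (0 : ℝ) < π ^ 2 := by positivity
  calc 2 / π ^ 2 * ‖p‖ ^ 2 ≤ 2 / π ^ 2 * (π ^ 2 / 2 * dispersion p) := by gcongr
    _ = dispersion p := by field_simp

/-- The dispersion relation is positive on `[-π,π]^d ∖ {0}`. [folklore] -/
theorem dispersion_pos_of_mem_brillouin {p : Fin d → ℝ} (hp : p ∈ brillouin d) (hp0 : p ≠ 0) :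
    0 < dispersion p :=
  lt_of_lt_of_le (by have := norm_pos_iff.2 hp0; positivity) (mul_norm_sq_le_dispersion hp)

/-! ### Integrability of `1/ε` on the Brillouin zone for `d ≥ 3` -/

variable (d) in
/-- **ADS15's transience condition for the nearest-neighbour model in `d ≥ 3`**
(Aizenman–Duminil-Copin–Sidoravicius, CMP 334 (2015), §1.4, arXiv v3 eq. (1.18)
`∫ dp/E(p) < ∞`, and "`E(p) ≈ |p|²` in case (1)", so (1.18) holds for `d > 2`): the function
`1[p ∈ [-π,π]^d] / ε(p)`
is Lebesgue integrable on `ℝ^d` for `d ≥ 3` (it is `O(‖p‖^{-2})`, and `‖p‖^{-2}` is locally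
integrable in dimension `> 2`, Mathlib `MeasureTheory.locallyIntegrable_of_norm_le_rpow`). [cite: AizenmanDuminilCopinSidoraviciusCMP2015, §1.4, arXiv v3 eq. (1.18)] -/
theorem integrable_indicator_inv_dispersion (hd : 3 ≤ d) :
    Integrable ((brillouin d).indicator fun p : Fin d → ℝ => 1 / dispersion p) volume := by
  set g : (Fin d → ℝ) → ℝ := fun p => 1 / dispersion p with hg
  set f := (brillouin d).indicator g with hf
  have hmeas : AEStronglyMeasurable f volume :=
    (Measurable.indicator (measurable_const.div (continuous_dispersion d).measurable)
      (measurableSet_brillouin d)).aestronglyMeasurable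
  have hdecay : ∀ p, ‖f p‖ ≤ π ^ 2 / 2 * ‖p‖ ^ (-(2 : ℝ)) := by
    intro p
    by_cases hp : p ∈ brillouin d
    · rcases eq_or_ne p 0 with rfl | hp0
      · have h0 : f 0 = 0 := by simp [hf, hg, dispersion]
        rw [h0, norm_zero]
        exact mul_nonneg (by positivity) (Real.rpow_nonneg (norm_nonneg _) _)
      · have hpos : 0 < ‖p‖ := norm_pos_iff.2 hp0
        have hε : 2 / π ^ 2 * ‖p‖ ^ 2 ≤ dispersion p := mul_norm_sq_le_dispersion hp
        have hεpos : 0 < dispersion p := dispersion_pos_of_mem_brillouin hp hp0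
        rw [hf, Set.indicator_of_mem hp, hg, Real.norm_eq_abs, abs_of_nonneg (by positivity),
          Real.rpow_neg hpos.le, Real.rpow_two]
        calc 1 / dispersion p ≤ 1 / (2 / π ^ 2 * ‖p‖ ^ 2) :=
            one_div_le_one_div_of_le (by positivity) hε
          _ = π ^ 2 / 2 * (‖p‖ ^ 2)⁻¹ := by
            have hπ : (π : ℝ) ≠ 0 := Real.pi_ne_zero
            field_simp
    · rw [hf, Set.indicator_of_notMem hp, norm_zero]
      exact mul_nonneg (by positivity) (Real.rpow_nonneg (norm_nonneg _) _)
  have hrank : Module.finrank ℝ (Fin d → ℝ) = d := Module.finrank_fin_fun ℝ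
  have hloc : LocallyIntegrable f volume :=
    locallyIntegrable_of_norm_le_rpow (by rw [hrank]; omega)
      (by rw [hrank]; exact_mod_cast (by omega : 2 < d)) (Eventually.of_forall hdecay) hmeas
  have hK : IntegrableOn f (brillouin d) volume :=
    hloc.integrableOn_isCompact (isCompact_brillouin d)
  have hK' : IntegrableOn g (brillouin d) volume :=
    (integrableOn_congr_fun (Set.eqOn_indicator (s := brillouin d) (f := g))
      (measurableSet_brillouin d)).1 hK
  exact (integrable_indicator_iff (measurableSet_brillouin d)).2 hK'


/-! ### Decay of the lattice Green function (Riemann–Lebesgue) -/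

/-- The linear functional `p ↦ -(2π)⁻¹ ∑ᵢ zᵢ pᵢ` on `ℝ^d` attached to `z ∈ ℤ^d`, chosen so that
Mathlib's Fourier character gives `𝐞(-w_z(p)) = e^{i p·z}`. [folklore] -/
def phaseFunctional (z : Site d) : StrongDual ℝ (Fin d → ℝ) :=
  -(1 / (2 * π)) • ∑ i, (z i : ℝ) • ContinuousLinearMap.proj (R := ℝ) (φ := fun _ : Fin d => ℝ) i

/-- Evaluation of `phaseFunctional`. [folklore] -/
theorem phaseFunctional_apply (z : Site d) (p : Fin d → ℝ) :
    phaseFunctional z p = -(1 / (2 * π)) * ∑ i, p i * (z i : ℝ) := by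
  simp [phaseFunctional, mul_comm]

/-- `𝐞(-w_z(p)) = exp (i p·z)`. [folklore] -/
theorem fourierChar_neg_phaseFunctional (z : Site d) (p : Fin d → ℝ) :
    ((𝐞 (-(phaseFunctional z p)) : Circle) : ℂ) =
      Complex.exp (((∑ i, p i * (z i : ℝ) : ℝ) : ℂ) * Complex.I) := by
  rw [Real.fourierChar_apply, phaseFunctional_apply]
  congr 2
  push_cast
  have hπ : (π : ℂ) ≠ 0 := by exact_mod_cast Real.pi_ne_zero
  field_simp

/-- `‖z‖_∞ ≤ 2π ‖w_z‖`: the functional `w_z` is large when `z` is. [folklore] -/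
theorem norm_le_norm_phaseFunctional (z : Site d) : ‖z‖ ≤ 2 * π * ‖phaseFunctional z‖ := by
  refine (pi_norm_le_iff_of_nonneg (by positivity)).2 fun j => ?_
  have h := (phaseFunctional z).le_opNorm (Pi.single j 1)
  rw [phaseFunctional_apply] at h
  have hsum : ∑ i, (Pi.single j (1 : ℝ) : Fin d → ℝ) i * (z i : ℝ) = z j := by
    rw [Finset.sum_eq_single j]
    · simp
    · intro i _ hij; simp [Pi.single_eq_of_ne hij]
    · intro hj; exact absurd (mem_univ j) hj
  rw [hsum, Pi.norm_single, norm_one, mul_one, Real.norm_eq_abs, abs_mul, abs_neg,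
    abs_of_pos (by positivity : (0 : ℝ) < 1 / (2 * π))] at h
  rw [Int.norm_eq_abs, ← Int.cast_abs]
  have hπ : (0 : ℝ) < 2 * π := by positivity
  calc ((|z j| : ℤ) : ℝ) = |(z j : ℝ)| := Int.cast_abs
    _ = 2 * π * (1 / (2 * π) * |(z j : ℝ)|) := by field_simp
    _ ≤ 2 * π * ‖phaseFunctional z‖ := by gcongr

variable (d) in
/-- `z ↦ w_z` tends to infinity (leaves every compact set of the dual space) along the cofinite
filter of `ℤ^d`. [folklore] -/
theorem tendsto_phaseFunctional_cocompact :
    Tendsto (phaseFunctional (d := d)) cofinite (cocompact (StrongDual ℝ (Fin d → ℝ))) := by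
  have h1 : Tendsto (fun z : Site d => ‖z‖) cofinite atTop := by
    rw [← cocompact_eq_cofinite (Site d)]
    exact tendsto_norm_cocompact_atTop
  have h2 : Tendsto (fun z : Site d => ‖phaseFunctional z‖) cofinite atTop := by
    refine tendsto_atTop_mono (fun z => ?_) (h1.atTop_div_const (by positivity : (0 : ℝ) < 2 * π))
    rw [div_le_iff₀ (by positivity : (0 : ℝ) < 2 * π), mul_comm]
    exact norm_le_norm_phaseFunctional z
  rw [← Metric.cobounded_eq_cocompact]
  exact tendsto_norm_atTop_iff_cobounded.1 h2

/-- The Green integral as the real part of a Fourier integral in Mathlib's normalisation: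
`∫_{[-π,π]^d} cos(p·z)/ε(p) dp = Re ∫ 𝐞(-w_z(p)) • (1[p ∈ [-π,π]^d]/ε(p)) dp` (`d ≥ 3`, so that the
integrand is integrable and `Re` commutes with the integral). [folklore] -/
theorem setIntegral_cos_div_dispersion_eq_re (hd : 3 ≤ d) (z : Site d) :
    ∫ p in brillouin d, Real.cos (∑ i, p i * (z i : ℝ)) / dispersion p =
      (∫ p, 𝐞 (-(phaseFunctional z p)) •
        (((brillouin d).indicator (fun p : Fin d → ℝ => 1 / dispersion p) p : ℝ) : ℂ)).re := by
  set g : (Fin d → ℝ) → ℝ := (brillouin d).indicator fun p => 1 / dispersion p with hg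
  have hgi : Integrable (fun p => ((g p : ℝ) : ℂ)) volume :=
    (integrable_indicator_inv_dispersion d hd).ofReal
  -- the complex integrand and its integrability
  have hint : Integrable (fun p : Fin d → ℝ =>
      Complex.exp (((∑ i, p i * (z i : ℝ) : ℝ) : ℂ) * Complex.I) * ((g p : ℝ) : ℂ)) volume := by
    refine hgi.bdd_mul (c := 1) ?_ (Eventually.of_forall fun p => ?_)
    · exact (Complex.continuous_exp.comp ((Complex.continuous_ofReal.comp (by fun_prop)).mul
        continuous_const)).aestronglyMeasurable
    · rw [Complex.norm_exp_ofReal_mul_I]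
  have hsmul : ∀ p : Fin d → ℝ, 𝐞 (-(phaseFunctional z p)) • ((g p : ℝ) : ℂ) =
      Complex.exp (((∑ i, p i * (z i : ℝ) : ℝ) : ℂ) * Complex.I) * ((g p : ℝ) : ℂ) := fun p => by
    rw [Circle.smul_def, fourierChar_neg_phaseFunctional, smul_eq_mul]
  simp_rw [hsmul]
  have hre := integral_re hint
  simp only [RCLike.re_to_complex] at hre
  rw [← hre]
  simp_rw [Complex.re_mul_ofReal, Complex.exp_ofReal_mul_I_re]
  rw [← integral_indicator (measurableSet_brillouin d)]
  refine integral_congr_ae (Eventually.of_forall fun p => ?_)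
  simp only [hg]
  by_cases hp : p ∈ brillouin d
  · simp only [Set.indicator_of_mem hp]
    ring
  · simp only [Set.indicator_of_notMem hp, mul_zero]

variable (d) in
/-- **Decay of the lattice Green function**: for `d ≥ 3`, `G(z) → 0` as `|z| → ∞` (along the
cofinite filter of `ℤ^d`), by the Riemann–Lebesgue lemma applied to the integrable function
`1[p ∈ [-π,π]^d]/ε(p)` (Mathlib `tendsto_integral_exp_smul_cocompact`). This is the input
"`G(x,y) → 0`" behind Aizenman–Duminil-Copin–Sidoravicius, CMP 334 (2015), §3.3, arXiv v3
eq. (3.16). [cite: AizenmanDuminilCopinSidoraviciusCMP2015, §3.3, arXiv v3 eq. (3.16)] -/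
theorem tendsto_latticeGreen_cofinite (hd : 3 ≤ d) :
    Tendsto (latticeGreen (d := d)) cofinite (𝓝 0) := by
  set F : (Fin d → ℝ) → ℂ := fun p =>
    (((brillouin d).indicator (fun p : Fin d → ℝ => 1 / dispersion p) p : ℝ) : ℂ) with hF
  have hRL := (tendsto_integral_exp_smul_cocompact F volume).comp
    (tendsto_phaseFunctional_cocompact d)
  have hre : Tendsto (fun z : Site d =>
      (∫ p, 𝐞 (-(phaseFunctional z p)) • F p).re / (2 * π) ^ d) cofinite (𝓝 0) := by
    simpa using ((Complex.continuous_re.tendsto 0).comp hRL).div_const ((2 * π) ^ d)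
  refine hre.congr fun z => ?_
  rw [latticeGreen, setIntegral_cos_div_dispersion_eq_re hd z]

/-! ### Cesàro averages over blocks -/

variable (d) in
/-- **Double block averages of a decaying kernel vanish**: if `G(z) → 0` as `|z| → ∞` on `ℤ^d`
(`d ≥ 1`), then `|Λ_N|⁻² ∑_{x,y ∈ Λ_N} G(x - y) → 0`, `Λ_N = [-N,N]^d`. Elementary
(finitely many large values of `G`, each met at most once per row). [folklore] -/
theorem tendsto_blockAverage_of_tendsto_cofinite (hd : 1 ≤ d) {G : Site d → ℝ}
    (hG : Tendsto G cofinite (𝓝 0)) :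
    Tendsto (fun N : ℕ => (∑ x ∈ box d N, ∑ y ∈ box d N, G (x - y)) / ((#(box d N) : ℝ) ^ 2))
      atTop (𝓝 0) := by
  rw [Metric.tendsto_nhds]
  intro ε hε
  -- the finitely many `z` with `|G z| ≥ ε / 2`
  have hfin : {z : Site d | ε / 2 ≤ |G z|}.Finite := by
    have h : G ⁻¹' Metric.ball 0 (ε / 2) ∈ cofinite := hG (Metric.ball_mem_nhds 0 (half_pos hε))
    refine (Filter.mem_cofinite.1 h).subset fun z hz => ?_
    simpa [Real.dist_eq] using hz
  set T := hfin.toFinset with hT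
  set K := ∑ z ∈ T, |G z| with hK
  have hK0 : 0 ≤ K := sum_nonneg fun z _ => abs_nonneg _
  -- one row of the double sum
  have hrow : ∀ (N : ℕ) (x : Site d),
      ∑ y ∈ box d N, |G (x - y)| ≤ K + #(box d N) * (ε / 2) := by
    intro N x
    rw [← sum_filter_add_sum_filter_not (box d N) (fun y => x - y ∈ T)]
    refine add_le_add ?_ ?_
    · calc ∑ y ∈ (box d N).filter (fun y => x - y ∈ T), |G (x - y)|
          = ∑ z ∈ ((box d N).filter (fun y => x - y ∈ T)).image (fun y => x - y), |G z| := by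
            rw [Finset.sum_image]
            intro y _ y' _ h
            exact sub_right_injective h
        _ ≤ K := by
            refine sum_le_sum_of_subset_of_nonneg (fun z hz => ?_) fun _ _ _ => abs_nonneg _
            simp only [Finset.mem_image, Finset.mem_filter] at hz
            obtain ⟨y, ⟨-, hy⟩, rfl⟩ := hz
            exact hy
    · calc ∑ y ∈ (box d N).filter (fun y => x - y ∉ T), |G (x - y)|
          ≤ ∑ y ∈ (box d N).filter (fun y => x - y ∉ T), ε / 2 := by
            refine sum_le_sum fun y hy => ?_
            have hy' := (Finset.mem_filter.1 hy).2
            rw [hT, Set.Finite.mem_toFinset] at hy'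
            exact (not_le.1 hy').le
        _ = #((box d N).filter (fun y => x - y ∉ T)) * (ε / 2) := by
            rw [sum_const, nsmul_eq_mul]
        _ ≤ #(box d N) * (ε / 2) := by
            gcongr
            exact filter_subset _ _
  -- the size of the box
  have hcard : ∀ N : ℕ, (2 * N + 1 : ℝ) ≤ #(box d N) := fun N => by
    rw [card_box]
    push_cast
    calc (2 * N + 1 : ℝ) = (2 * N + 1) ^ 1 := (pow_one _).symm
      _ ≤ (2 * N + 1) ^ d := pow_le_pow_right₀ (by linarith [(Nat.cast_nonneg N : (0 : ℝ) ≤ N)]) hd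
  obtain ⟨N₀, hN₀⟩ := exists_nat_gt (K / ε)
  refine eventually_atTop.2 ⟨N₀, fun N hN => ?_⟩
  have hB : (0 : ℝ) < #(box d N) := by exact_mod_cast (box_nonempty d N).card_pos
  have htot : |∑ x ∈ box d N, ∑ y ∈ box d N, G (x - y)| ≤
      #(box d N) * (K + #(box d N) * (ε / 2)) := by
    calc |∑ x ∈ box d N, ∑ y ∈ box d N, G (x - y)|
        ≤ ∑ x ∈ box d N, |∑ y ∈ box d N, G (x - y)| := abs_sum_le_sum_abs _ _
      _ ≤ ∑ x ∈ box d N, ∑ y ∈ box d N, |G (x - y)| :=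
          sum_le_sum fun x _ => abs_sum_le_sum_abs _ _
      _ ≤ ∑ x ∈ box d N, (K + #(box d N) * (ε / 2)) := sum_le_sum fun x _ => hrow N x
      _ = #(box d N) * (K + #(box d N) * (ε / 2)) := by rw [sum_const, nsmul_eq_mul]
  have hKlt : K < ε / 2 * #(box d N) := by
    have h1 : K < N₀ * ε := by rwa [div_lt_iff₀ hε] at hN₀
    have h2 : (N₀ : ℝ) ≤ N := by exact_mod_cast hN
    nlinarith [hcard N, hε]
  rw [Real.dist_eq, sub_zero, abs_div, abs_of_pos (by positivity : (0 : ℝ) < (#(box d N) : ℝ) ^ 2),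
    div_lt_iff₀ (by positivity)]
  calc |∑ x ∈ box d N, ∑ y ∈ box d N, G (x - y)| ≤ #(box d N) * (K + #(box d N) * (ε / 2)) := htot
    _ < #(box d N) * (ε / 2 * #(box d N) + #(box d N) * (ε / 2)) := by gcongr
    _ = ε * (#(box d N) : ℝ) ^ 2 := by ring

variable (d) in
/-- **ADS15 §3.3, arXiv v3 eq. (3.16), for the nearest-neighbour model in `d ≥ 3`**
(Aizenman–Duminil-Copin–Sidoravicius, CMP 334 (2015), §3.3): the lattice Green function
satisfies `lim_{N → ∞} |Λ_N|⁻² ∑_{x,y ∈ Λ_N} G(x - y) = 0`, `Λ_N = [-N,N]^d`. Proved from the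
Riemann–Lebesgue decay `tendsto_latticeGreen_cofinite` and the Cesàro lemma
`tendsto_blockAverage_of_tendsto_cofinite`. [cite: AizenmanDuminilCopinSidoraviciusCMP2015, §3.3, arXiv v3 eq. (3.16)] -/
theorem tendsto_latticeGreen_blockAverage (hd : 3 ≤ d) :
    Tendsto (fun N : ℕ =>
      (∑ x ∈ box d N, ∑ y ∈ box d N, latticeGreen (x - y)) / ((#(box d N) : ℝ) ^ 2))
      atTop (𝓝 0) :=
  tendsto_blockAverage_of_tendsto_cofinite d (by omega) (tendsto_latticeGreen_cofinite d hd)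

end Literature.Probability.LatticeModels
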